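import Mathlib
import Literature.LinearAlgebra.Matrix.PermanentLaplace
import Literature.Computability.AlgebraicComplexity.VonZurGathenSingPermHeight

/-!
# Bordering tools for the inner-size transfer `n → n + 1` of four-variable pencil ranks
# (crux `ValuativeGCT.ValuativeFlip`, stmt-ValiantsHypothesis-12624; wall-breaker axis k8 gen 1,
# "representation-stability transfer between sizes")

Helper file (`--supports stmt-ValiantsHypothesis-12624`) for line `four-row-count`, stub
`stub_fourRowPencilRank` in its `m`-free form `H` (`fourRowPencilRank_of_pencilCertificate`,
`Theorems/ValuativeGCTValuativeFlipFourRowTransfer.lean`): `T(n) ≤ finrank span{X_t · (∂_ij per_n)(M·X)}`.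
The transfer of that rank from inner size `n + 1` to `n + 2` (bordering a pencil by one row and one
column, `Theorems/ValuativeGCTValuativeFlipPencilBorder.lean`) rests on three elementary tools proved here:

* `pb_finite_setOf_finrank_lt` — GENERIC RANK IS ATTAINED COFINITELY: for an affine one-parameter family
  of finite families of vectors `G₀ i + μ • G₁ i`, the parameters `μ` at which the span has smaller
  dimension than at `μ = 0` form a finite set (left inverse of the coordinate map of an independent
  sub-family, a polynomial determinant with constant term `1`);
* `pb_permanent_submatrix_last_castSucc` / `…_castSucc_last` / `…_castSucc_castSucc` /
  `pb_submatrix_castSucc_castSucc` — the four kinds of maximal minors of a BORDERED matrix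
  `B = [[A, u], [vᵀ, z]]` (characterised by equations, no constructor): deleting the last row and a
  column `l` gives `Σ_i u_i · per A(i|l)` (Laplace along the border column), symmetrically for rows,
  deleting an old row and column is AFFINE in the corner `z` with slope `per A(k|l)`, and deleting the
  last row and column gives back `A`;
* `pb_aeval_pderiv_perPoly` — `(∂_{kl} per)(φ) = per (φ with row k and column l deleted)` for any
  algebra-valued point `φ` (von zur Gathen 1987 §2, polynomial form of
  `eval_pderiv_perPoly_eq_permanent_submatrix`).

All statements are folklore linear algebra / Laplace expansion (Minc, *Permanents* (1978) §1.2);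
nothing here is specific to the crux.
-/

set_option linter.dupNamespace false

namespace Summit.ValiantsHypothesis.ValiantsHypothesis.Theorems.ValuativeFlip

open scoped BigOperators Matrix Polynomial
open MvPolynomial

section GenericRank

/-- **Generic rank is attained off a finite set.**  For finite families `G₀, G₁` of vectors and the
affine family `G_μ i = G₀ i + μ • G₁ i`, the set of parameters `μ` with
`finrank (span (range G_μ)) < finrank (span (range G₀))` is finite: choose an independent sub-family
`G₀ ∘ a` spanning `span (range G₀)` and a left inverse `π` of its coordinate map; the matrix
`π (G_μ (a j)) i` is the value at `μ` of a polynomial matrix with value `1` at `μ = 0`, so its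
determinant is a nonzero polynomial in `μ`, and wherever it does not vanish `G_μ ∘ a` is independent.
[folklore] -/
theorem pb_finite_setOf_finrank_lt {K V ι : Type*} [Field K] [AddCommGroup V] [Module K V]
    [Fintype ι] (G₀ G₁ : ι → V) :
    Set.Finite {μ : K | Module.finrank K ↥(Submodule.span K (Set.range fun i => G₀ i + μ • G₁ i)) <
      Module.finrank K ↥(Submodule.span K (Set.range G₀))} := by
  classical
  obtain ⟨κ, a, ha, hspan, hli⟩ := exists_linearIndependent' K G₀
  haveI : Fintype κ := Fintype.ofInjective a ha
  have hcard : Fintype.card κ = Module.finrank K ↥(Submodule.span K (Set.range G₀)) := by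
    rw [← hspan]
    exact (finrank_span_eq_card hli).symm
  -- left inverse of the coordinate map of the independent sub-family
  have hTinj : LinearMap.ker (Finsupp.linearCombination K (G₀ ∘ a)) = ⊥ :=
    LinearMap.ker_eq_bot.mpr hli
  obtain ⟨π, hπ⟩ := (Finsupp.linearCombination K (G₀ ∘ a)).exists_leftInverse_of_injective hTinj
  have hπT : ∀ j : κ, π (G₀ (a j)) = Finsupp.single j 1 := by
    intro j
    have h1 : Finsupp.linearCombination K (G₀ ∘ a) (Finsupp.single j 1) = G₀ (a j) := by
      rw [Finsupp.linearCombination_single, Function.comp_apply, one_smul]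
    have h2 := LinearMap.congr_fun hπ (Finsupp.single j 1)
    rw [LinearMap.comp_apply, h1] at h2
    simpa using h2
  -- the polynomial matrix `P` and its values
  have hPeval : ∀ μ : K, (Matrix.of fun i j : κ =>
      Polynomial.C (π (G₀ (a j)) i) + Polynomial.X * Polynomial.C (π (G₁ (a j)) i)).map
        (Polynomial.eval μ) = Matrix.of fun i j => π (G₀ (a j) + μ • G₁ (a j)) i := by
    intro μ
    ext i j
    simp only [Matrix.map_apply, Matrix.of_apply, Polynomial.eval_add, Polynomial.eval_C,
      Polynomial.eval_mul, Polynomial.eval_X, map_add, map_smul, Finsupp.coe_add, Finsupp.coe_smul,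
      Pi.add_apply, Pi.smul_apply, smul_eq_mul]
  have hP0 : (Matrix.of fun i j : κ =>
      Polynomial.C (π (G₀ (a j)) i) + Polynomial.X * Polynomial.C (π (G₁ (a j)) i)).map
        (Polynomial.eval 0) = 1 := by
    rw [hPeval 0]
    ext i j
    simp only [zero_smul, add_zero, Matrix.of_apply, hπT j, Matrix.one_apply, Finsupp.single_apply]
    rcases eq_or_ne j i with h | h
    · subst h; simp
    · simp [h, Ne.symm h]
  have hdet : (Matrix.of fun i j : κ =>
      Polynomial.C (π (G₀ (a j)) i) + Polynomial.X * Polynomial.C (π (G₁ (a j)) i)).det ≠ 0 := by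
    intro h0
    have h1 := RingHom.map_det (Polynomial.evalRingHom (0 : K)) (Matrix.of fun i j : κ =>
      Polynomial.C (π (G₀ (a j)) i) + Polynomial.X * Polynomial.C (π (G₁ (a j)) i))
    rw [h0, map_zero, RingHom.mapMatrix_apply, Polynomial.coe_evalRingHom, hP0, Matrix.det_one] at h1
    exact zero_ne_one h1
  refine (Polynomial.finite_setOf_isRoot hdet).subset fun μ hμ => ?_
  -- off the roots, the sub-family `G_μ ∘ a` is independent, so the rank does not drop
  by_contra hroot
  simp only [Set.mem_setOf_eq, Polynomial.IsRoot.def] at hroot hμ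
  have hdetμ : (Matrix.of fun i j : κ => π (G₀ (a j) + μ • G₁ (a j)) i).det ≠ 0 := by
    rw [← hPeval μ]
    intro h0
    apply hroot
    have h1 := RingHom.map_det (Polynomial.evalRingHom μ) (Matrix.of fun i j : κ =>
      Polynomial.C (π (G₀ (a j)) i) + Polynomial.X * Polynomial.C (π (G₁ (a j)) i))
    rw [RingHom.mapMatrix_apply, Polynomial.coe_evalRingHom, h0] at h1
    exact h1
  have hliμ : LinearIndependent K ((fun i => G₀ i + μ • G₁ i) ∘ a) := by
    rw [Fintype.linearIndependent_iff]
    intro g hg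
    have hvec : (Matrix.of fun i j : κ => π (G₀ (a j) + μ • G₁ (a j)) i) *ᵥ g = 0 := by
      funext i
      have h1 := congrArg (fun x => π x i) hg
      simp only [Function.comp_apply, map_sum, map_smul, map_zero, Finsupp.coe_finsetSum,
        Finsupp.coe_smul, Finset.sum_apply, Pi.smul_apply, smul_eq_mul, Finsupp.coe_zero,
        Pi.zero_apply] at h1
      rw [Pi.zero_apply, ← h1, Matrix.mulVec, dotProduct]
      refine Finset.sum_congr rfl fun j _ => ?_
      rw [Matrix.of_apply, mul_comm]
    exact congr_fun (Matrix.eq_zero_of_mulVec_eq_zero hdetμ hvec)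
  have hle : Fintype.card κ ≤
      Module.finrank K ↥(Submodule.span K (Set.range fun i => G₀ i + μ • G₁ i)) := by
    have h1 := linearIndependent_iff_card_le_finrank_span.mp hliμ
    haveI : Module.Finite K ↥(Submodule.span K (Set.range fun i => G₀ i + μ • G₁ i)) :=
      Module.Finite.span_of_finite K (Set.finite_range _)
    exact h1.trans (Submodule.finrank_mono
      (Submodule.span_mono (Set.range_comp_subset_range a fun i => G₀ i + μ • G₁ i)))
  rw [hcard] at hle
  exact absurd hμ (not_lt.mpr hle)

/-- Corollary used by the transfer: there is a NONZERO parameter (indeed all but finitely many) at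
which the affine family spans at least as much as at `μ = 0`. [folklore] -/
theorem pb_exists_ne_zero_finrank_le {K V ι : Type*} [Field K] [Infinite K] [AddCommGroup V]
    [Module K V] [Fintype ι] (G₀ G₁ : ι → V) :
    ∃ μ : K, μ ≠ 0 ∧ Module.finrank K ↥(Submodule.span K (Set.range G₀)) ≤
      Module.finrank K ↥(Submodule.span K (Set.range fun i => G₀ i + μ • G₁ i)) := by
  have hfin := (pb_finite_setOf_finrank_lt G₀ G₁).union (Set.finite_singleton (0 : K))
  obtain ⟨μ, hμ⟩ := hfin.infinite_compl.nonempty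
  simp only [Set.mem_compl_iff, Set.mem_union, Set.mem_setOf_eq, Set.mem_singleton_iff,
    not_or, not_lt] at hμ
  exact ⟨μ, hμ.2, hμ.1⟩

end GenericRank

section Border

variable {S : Type*} [CommRing S] {n : ℕ}

/-- Index bookkeeping: inside `Fin (n+2)`, skipping the old index `castSucc k` sends the last index of
`Fin (n+1)` to the last index of `Fin (n+2)`. [folklore] -/
theorem pb_succAbove_castSucc_last (k : Fin (n + 1)) :
    (Fin.castSucc k).succAbove (Fin.last n) = Fin.last (n + 1) := by
  rw [Fin.succAbove_of_le_castSucc _ _ (Fin.castSucc_le_castSucc_iff.mpr (Fin.le_last k)),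
    Fin.succ_last]

omit [CommRing S] in
/-- Deleting the LAST row and the LAST column of a bordered matrix `B = [[A, u], [vᵀ, z]]` gives back
`A`. [folklore] -/
theorem pb_submatrix_last_last (B : Matrix (Fin (n + 2)) (Fin (n + 2)) S)
    (A : Matrix (Fin (n + 1)) (Fin (n + 1)) S) (hA : ∀ i j, B (Fin.castSucc i) (Fin.castSucc j) = A i j) :
    B.submatrix (Fin.last (n + 1)).succAbove (Fin.last (n + 1)).succAbove = A := by
  ext i j
  simp [hA]

/-- Deleting the last row and an OLD column `l` of a bordered matrix `B = [[A, u], [vᵀ, z]]`: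
Laplace expansion along the border column gives `per B(last | l) = Σ_i u_i · per A(i | l)`.
[Minc 1978 §1.2; folklore] -/
theorem pb_permanent_submatrix_last_castSucc (B : Matrix (Fin (n + 2)) (Fin (n + 2)) S)
    (A : Matrix (Fin (n + 1)) (Fin (n + 1)) S) (u : Fin (n + 1) → S)
    (hA : ∀ i j, B (Fin.castSucc i) (Fin.castSucc j) = A i j)
    (hu : ∀ i, B (Fin.castSucc i) (Fin.last (n + 1)) = u i) (l : Fin (n + 1)) :
    (B.submatrix (Fin.last (n + 1)).succAbove (Fin.castSucc l).succAbove).permanent =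
      ∑ i, u i * (A.submatrix i.succAbove l.succAbove).permanent := by
  rw [Matrix.permanent_eq_sum_column _ (Fin.last n)]
  refine Finset.sum_congr rfl fun i _ => ?_
  congr 1
  · rw [Matrix.submatrix_apply, Fin.succAbove_last, pb_succAbove_castSucc_last, hu]
  · congr 1
    ext a b
    simp [hA]

/-- Deleting an OLD row `k` and the last column of a bordered matrix `B = [[A, u], [vᵀ, z]]`:
Laplace expansion along the border row gives `per B(k | last) = Σ_j v_j · per A(k | j)`.
[Minc 1978 §1.2; folklore] -/
theorem pb_permanent_submatrix_castSucc_last (B : Matrix (Fin (n + 2)) (Fin (n + 2)) S)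
    (A : Matrix (Fin (n + 1)) (Fin (n + 1)) S) (v : Fin (n + 1) → S)
    (hA : ∀ i j, B (Fin.castSucc i) (Fin.castSucc j) = A i j)
    (hv : ∀ j, B (Fin.last (n + 1)) (Fin.castSucc j) = v j) (k : Fin (n + 1)) :
    (B.submatrix (Fin.castSucc k).succAbove (Fin.last (n + 1)).succAbove).permanent =
      ∑ j, v j * (A.submatrix k.succAbove j.succAbove).permanent := by
  rw [Matrix.permanent_eq_sum_row _ (Fin.last n)]
  refine Finset.sum_congr rfl fun j _ => ?_
  congr 1
  · rw [Matrix.submatrix_apply, Fin.succAbove_last, pb_succAbove_castSucc_last, hv]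
  · congr 1
    ext a b
    simp [hA]

/-- Deleting an OLD row `k` and an OLD column `l` of a bordered matrix `B = [[A, u], [vᵀ, z]]` is
AFFINE in the corner: `per B(k | l) = z · per A(k | l) + per B₀(k | l)`, where `B₀` is `B` with the
corner replaced by `0` (Laplace expansion along the border row; the corner's cofactor is `A(k | l)`,
the other cofactors do not see the last row). [Minc 1978 §1.2; folklore] -/
theorem pb_permanent_submatrix_castSucc_castSucc (B B₀ : Matrix (Fin (n + 2)) (Fin (n + 2)) S)
    (A : Matrix (Fin (n + 1)) (Fin (n + 1)) S)
    (hA : ∀ i j, B (Fin.castSucc i) (Fin.castSucc j) = A i j)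
    (hrows : ∀ i j, B₀ (Fin.castSucc i) j = B (Fin.castSucc i) j)
    (hlast : ∀ j, B₀ (Fin.last (n + 1)) (Fin.castSucc j) = B (Fin.last (n + 1)) (Fin.castSucc j))
    (h0 : B₀ (Fin.last (n + 1)) (Fin.last (n + 1)) = 0) (k l : Fin (n + 1)) :
    (B.submatrix (Fin.castSucc k).succAbove (Fin.castSucc l).succAbove).permanent =
      B (Fin.last (n + 1)) (Fin.last (n + 1)) * (A.submatrix k.succAbove l.succAbove).permanent +
        (B₀.submatrix (Fin.castSucc k).succAbove (Fin.castSucc l).succAbove).permanent := by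
  rw [Matrix.permanent_eq_sum_row (B.submatrix _ _) (Fin.last n),
    Matrix.permanent_eq_sum_row (B₀.submatrix _ _) (Fin.last n), Fin.sum_univ_castSucc,
    Fin.sum_univ_castSucc]
  -- the corner terms
  have hcB : (B.submatrix (Fin.castSucc k).succAbove (Fin.castSucc l).succAbove) (Fin.last n) (Fin.last n) *
      ((B.submatrix (Fin.castSucc k).succAbove (Fin.castSucc l).succAbove).submatrix
        (Fin.last n).succAbove (Fin.last n).succAbove).permanent =
      B (Fin.last (n + 1)) (Fin.last (n + 1)) * (A.submatrix k.succAbove l.succAbove).permanent := by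
    congr 1
    · rw [Matrix.submatrix_apply, pb_succAbove_castSucc_last, pb_succAbove_castSucc_last]
    · congr 1
      ext a b
      simp [hA]
  have hcB₀ : (B₀.submatrix (Fin.castSucc k).succAbove (Fin.castSucc l).succAbove) (Fin.last n) (Fin.last n) *
      ((B₀.submatrix (Fin.castSucc k).succAbove (Fin.castSucc l).succAbove).submatrix
        (Fin.last n).succAbove (Fin.last n).succAbove).permanent = 0 := by
    rw [Matrix.submatrix_apply, pb_succAbove_castSucc_last, pb_succAbove_castSucc_last, h0, zero_mul]
  -- the other terms agree
  have hsum : ∀ j : Fin n,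
      (B.submatrix (Fin.castSucc k).succAbove (Fin.castSucc l).succAbove) (Fin.last n) (Fin.castSucc j) *
        ((B.submatrix (Fin.castSucc k).succAbove (Fin.castSucc l).succAbove).submatrix
          (Fin.last n).succAbove (Fin.castSucc j).succAbove).permanent =
      (B₀.submatrix (Fin.castSucc k).succAbove (Fin.castSucc l).succAbove) (Fin.last n) (Fin.castSucc j) *
        ((B₀.submatrix (Fin.castSucc k).succAbove (Fin.castSucc l).succAbove).submatrix
          (Fin.last n).succAbove (Fin.castSucc j).succAbove).permanent := by
    intro j
    congr 1
    · rw [Matrix.submatrix_apply, Matrix.submatrix_apply, pb_succAbove_castSucc_last,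
        Fin.castSucc_succAbove_castSucc, hlast]
    · congr 1
      ext a b
      simp only [Matrix.submatrix_apply, Fin.succAbove_last, Fin.castSucc_succAbove_castSucc, hrows]
  rw [hcB, hcB₀, add_zero, Finset.sum_congr rfl fun j _ => hsum j]
  ring

end Border

section PderivLink

open Literature.Computability.AlgebraicComplexity

/-- **`(∂_{kl} per)(φ) = per φ(k | l)`** in any commutative `K`-algebra: substituting a point `φ` into
the partial derivative `∂ per_{n+1} / ∂ x_{kl}` of the generic permanent gives the permanent of the
matrix `(φ (i, j))` with row `k` and column `l` deleted (von zur Gathen 1987 §2; the polynomial form of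
`eval_pderiv_perPoly_eq_permanent_submatrix`). [folklore] -/
theorem pb_aeval_pderiv_perPoly {K A : Type*} [CommRing K] [CommRing A] [Algebra K A] {n : ℕ}
    (φ : Fin (n + 1) × Fin (n + 1) → A) (k l : Fin (n + 1)) :
    MvPolynomial.aeval φ (MvPolynomial.pderiv (k, l) (perPoly (Fin (n + 1)) K)) =
      ((Matrix.of fun i j => φ (i, j)).submatrix k.succAbove l.succAbove).permanent := by
  rw [VonZurGathen.pderiv_perPoly, VonZurGathen.aeval_subperm_X,
    Matrix.subperm_eq_permanent_of_equiv _ (finSuccAboveEquiv l) (finSuccAboveEquiv k)]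
  rfl

/-- Substituting a point `φ` into the generic permanent gives the permanent of `(φ (i, j))`.
[Bürgisser 2000 (2.2); folklore] -/
theorem pb_aeval_perPoly {K A : Type*} [CommRing K] [CommRing A] [Algebra K A] {ι : Type*}
    [Fintype ι] [DecidableEq ι] (φ : ι × ι → A) :
    MvPolynomial.aeval φ (perPoly ι K) = (Matrix.of fun i j => φ (i, j)).permanent := by
  simp [perPoly, Matrix.permanent, map_sum, map_prod]

/-- Ring homomorphisms commute with permanents (replayed one-liner; the tree's
`Matrix.permanent_map_ringHom` sits behind heavy imports). [folklore] -/
theorem pb_permanent_map {ι R R' : Type*} [Fintype ι] [DecidableEq ι] [CommRing R] [CommRing R']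
    (M : Matrix ι ι R) (f : R →+* R') : (M.map f).permanent = f M.permanent := by
  simp [Matrix.permanent, map_sum, map_prod]

end PderivLink

end Summit.ValiantsHypothesis.ValiantsHypothesis.Theorems.ValuativeFlip
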